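import Summits.NavierStokesRegularity.NavierStokesRegularity.Theorems.ExtremiserTransienceTwoThirdsCutoff
import Summits.NavierStokesRegularity.NavierStokesRegularity.Theorems.ExtremiserTransienceKStarAttainedDensity
import HarnessLib

/-!
# Route `ExtremiserTransience`, crux `NearExtremalTransiencePerFlow` (stmt-NavierStokesRegularity-26567), LINE g10-1 «two_thirds»
# (ns-idea-10 g10), stub S2 `FirstOrderIdentity`: the THIN-SHELL WEIGHT of S2 at scale `ρ` (`R = ρ⁸`, `ℓ = ρ⁷`)

Helper file for S2 (`--supports stmt-NavierStokesRegularity-26567`).  Specialisation of `exists_shellCutoff` (`…TwoThirdsCutoff`) to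
the shell `r₁ = R + ℓ/4`, `r₂ = R + 3ℓ/4` with `R = ρ⁸`, `ℓ = ρ⁷`, `ρ ≥ 2`, and derivative scale `D = 1/ℓ`, in exactly the form
consumed by `remainder_bound` and `layer_bound`: `χ` smooth with compact support, `0 ≤ χ ≤ 1`, `χ = 1` on `B(c,R)`, `χ = 0` off
`B(c,R+ℓ)` (indeed near every point with `‖x − c‖ ≥ R + ℓ`), `tsupport χ ⊆ B(c,3R/2)`, `|χ| ≤ 1_{B(c,R+ℓ)}`,
`‖Dχ‖ ≤ (K₁/ℓ)·1_Λ`, `‖D²χ‖ ≤ (2K₂/ℓ²)·1_Λ`, `‖D³χ‖ ≤ 6K₃/ℓ³` on `Λ = B(c,R+ℓ) ∖ B(c,R)` (`cutoff_package`).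

HONEST FRAMING: elementary calculus; nothing about Navier–Stokes regularity or blow-up is proved; S2, the crux ⟨26567⟩ and NS
regularity are OPEN; no summit is proved by a line. [folklore]
-/

noncomputable section

open scoped Topology ContDiff Nat
open Set Filter Metric

namespace Summit.NavierStokesRegularity.NavierStokesRegularity.Theorems.NearExtremalTransiencePerFlow.TwoThirds

-- the summit's namespace repeats the problem name by convention (D-0017)
set_option linter.dupNamespace false

/-- **THE THIN-SHELL WEIGHT AT SCALE `ρ`** (see the module docstring). [folklore] -/
theorem cutoff_package : ∃ K : ℕ → ℝ, (∀ n, 0 ≤ K n) ∧ ∀ (c : EuclideanSpace ℝ (Fin 3)) (ρ : ℝ), 2 ≤ ρ →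
    ∃ χ : EuclideanSpace ℝ (Fin 3) → ℝ, ContDiff ℝ (⊤ : ℕ∞) χ ∧ HasCompactSupport χ ∧ (∀ x, 0 ≤ χ x ∧ χ x ≤ 1) ∧
      (∀ x ∈ ball c (ρ ^ 8), χ x = 1) ∧ (∀ x, x ∉ ball c (ρ ^ 8 + ρ ^ 7) → χ x = 0) ∧
      (∀ x, ρ ^ 8 + ρ ^ 7 ≤ ‖x - c‖ → χ =ᶠ[𝓝 x] fun _ => 0) ∧
      tsupport χ ⊆ ball c (3 / 2 * ρ ^ 8) ∧
      (∀ x, |χ x| ≤ (ball c (ρ ^ 8 + ρ ^ 7)).indicator (fun _ => (1 : ℝ)) x) ∧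
      (∀ x, ‖fderiv ℝ χ x‖ ≤ K 1 / ρ ^ 7 * (ball c (ρ ^ 8 + ρ ^ 7) \ ball c (ρ ^ 8)).indicator (fun _ => (1 : ℝ)) x) ∧
      (∀ x, ‖iteratedFDeriv ℝ 2 χ x‖ ≤
        2 * K 2 / (ρ ^ 7) ^ 2 * (ball c (ρ ^ 8 + ρ ^ 7) \ ball c (ρ ^ 8)).indicator (fun _ => (1 : ℝ)) x) ∧
      (∀ x ∈ ball c (ρ ^ 8 + ρ ^ 7) \ ball c (ρ ^ 8), ‖fderiv ℝ χ x‖ ≤ K 1 / ρ ^ 7) ∧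
      (∀ x ∈ ball c (ρ ^ 8 + ρ ^ 7) \ ball c (ρ ^ 8), ‖iteratedFDeriv ℝ 2 χ x‖ ≤ 2 * K 2 / (ρ ^ 7) ^ 2) ∧
      (∀ x ∈ ball c (ρ ^ 8 + ρ ^ 7) \ ball c (ρ ^ 8), ‖iteratedFDeriv ℝ 3 χ x‖ ≤ 6 * K 3 / (ρ ^ 7) ^ 3) := by
  obtain ⟨K, hK0, hcut⟩ := exists_shellCutoff
  refine ⟨K, hK0, fun c ρ hρ => ?_⟩
  have hρ0 : 0 < ρ := by linarith
  have hρ1 : 1 ≤ ρ := by linarith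
  set R : ℝ := ρ ^ 8 with hR
  set ℓ : ℝ := ρ ^ 7 with hℓ
  have hR0 : 0 < R := by positivity
  have hℓ0 : 0 < ℓ := by positivity
  have hℓR : 2 * ℓ ≤ R := by
    rw [hℓ, hR, show ρ ^ 8 = ρ * ρ ^ 7 by ring]
    exact mul_le_mul_of_nonneg_right hρ (by positivity)
  obtain ⟨χ, hχs, hχ01, hone, hzero, hcs, htsupp, hin, hout, hbound⟩ :=
    hcut c (R + ℓ / 4) (R + 3 * ℓ / 4) (by positivity) (by linarith)
  -- the shell parameter `w = r₂² − r₁² = Rℓ + ℓ²/2`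
  have hw : (R + 3 * ℓ / 4) ^ 2 - (R + ℓ / 4) ^ 2 = R * ℓ + ℓ ^ 2 / 2 := by ring
  have hD1 : 1 ≤ 2 * ((R + 3 * ℓ / 4) ^ 2 - (R + ℓ / 4) ^ 2) * ℓ⁻¹ ^ 2 := by
    rw [hw]
    have e : 2 * (R * ℓ + ℓ ^ 2 / 2) * ℓ⁻¹ ^ 2 = 2 * R / ℓ + 1 := by field_simp
    rw [e]
    have : 0 ≤ 2 * R / ℓ := by positivity
    linarith
  have hD2 : ∀ x ∈ ball c (R + ℓ), ‖x - c‖ ≤ 2 * ((R + 3 * ℓ / 4) ^ 2 - (R + ℓ / 4) ^ 2) * ℓ⁻¹ := by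
    intro x hx
    rw [mem_ball, dist_eq_norm] at hx
    rw [hw]
    have e : 2 * (R * ℓ + ℓ ^ 2 / 2) * ℓ⁻¹ = 2 * R + ℓ := by field_simp
    rw [e]; linarith
  -- derivative bounds on the layer (indeed on `B(c,R+ℓ)`)
  have hder : ∀ (n : ℕ), ∀ x ∈ ball c (R + ℓ), ‖iteratedFDeriv ℝ n χ x‖ ≤ n ! * K n * ℓ⁻¹ ^ n := fun n x hx =>
    hbound n ℓ⁻¹ x (by positivity) hD1 (hD2 x hx)
  -- vanishing of the derivatives off the layer
  have hoff : ∀ (n : ℕ), 1 ≤ n → ∀ x, x ∉ ball c (R + ℓ) \ ball c R → iteratedFDeriv ℝ n χ x = 0 := by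
    intro n hn x hx
    rw [Set.mem_sdiff, not_and_or, not_not] at hx
    rcases hx with hx | hx
    · rw [mem_ball, dist_eq_norm, not_lt] at hx
      exact hout n x hn (by linarith)
    · rw [mem_ball, dist_eq_norm] at hx
      exact hin n x hn (by linarith)
  have h1 : ((1 : ℕ) ! : ℝ) * K 1 * ℓ⁻¹ ^ 1 = K 1 / ρ ^ 7 := by rw [hℓ]; simp [div_eq_mul_inv]
  have h2 : ((2 : ℕ) ! : ℝ) * K 2 * ℓ⁻¹ ^ 2 = 2 * K 2 / (ρ ^ 7) ^ 2 := by
    rw [hℓ, show ((2 : ℕ) ! : ℝ) = 2 by norm_num [Nat.factorial]]; field_simp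
  have h3 : ((3 : ℕ) ! : ℝ) * K 3 * ℓ⁻¹ ^ 3 = 6 * K 3 / (ρ ^ 7) ^ 3 := by
    rw [hℓ, show ((3 : ℕ) ! : ℝ) = 6 by norm_num [Nat.factorial]]; field_simp
  refine ⟨χ, hχs, hcs, hχ01, fun x hx => ?_, fun x hx => ?_, fun x hx => ?_, ?_, fun x => ?_, fun x => ?_, fun x => ?_,
    fun x hx => ?_, fun x hx => ?_, fun x hx => ?_⟩
  · rw [mem_ball, dist_eq_norm] at hx
    exact hone x (by linarith)
  · rw [mem_ball, dist_eq_norm, not_lt] at hx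
    exact hzero x (by linarith)
  · have hopen : IsOpen {y : EuclideanSpace ℝ (Fin 3) | R + 3 * ℓ / 4 < ‖y - c‖} :=
      isOpen_lt continuous_const (continuous_id.sub continuous_const).norm
    filter_upwards [hopen.mem_nhds (show R + 3 * ℓ / 4 < ‖x - c‖ by linarith)] with y hy
    exact hzero y (le_of_lt hy)
  · refine htsupp.trans fun y hy => ?_
    rw [mem_closedBall, dist_eq_norm] at hy
    rw [mem_ball, dist_eq_norm]
    linarith
  · by_cases hx : x ∈ ball c (R + ℓ)
    · rw [indicator_of_mem hx, abs_of_nonneg (hχ01 x).1]; exact (hχ01 x).2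
    · rw [indicator_of_notMem hx]
      rw [mem_ball, dist_eq_norm, not_lt] at hx
      rw [hzero x (by linarith), abs_zero]
  · by_cases hx : x ∈ ball c (R + ℓ) \ ball c R
    · rw [indicator_of_mem hx, mul_one, ← norm_iteratedFDeriv_one, ← h1]
      exact hder 1 x hx.1
    · rw [indicator_of_notMem hx, mul_zero, ← norm_iteratedFDeriv_one, hoff 1 le_rfl x hx, norm_zero]
  · by_cases hx : x ∈ ball c (R + ℓ) \ ball c R
    · rw [indicator_of_mem hx, mul_one, ← h2]
      exact hder 2 x hx.1
    · rw [indicator_of_notMem hx, mul_zero, hoff 2 (by norm_num) x hx, norm_zero]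
  · rw [← norm_iteratedFDeriv_one, ← h1]; exact hder 1 x hx.1
  · rw [← h2]; exact hder 2 x hx.1
  · rw [← h3]; exact hder 3 x hx.1

end Summit.NavierStokesRegularity.NavierStokesRegularity.Theorems.NearExtremalTransiencePerFlow.TwoThirds

end
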